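import Literature.MathematicalPhysics.QuantumFieldTheory.Balaban1983to89.Node00.TorusCoverGaugeTokensRPrint
import HarnessLib

/-!
# N07 [B11] (= [15] = [Balaban1985Variational]) Sect. F, S6 HEAD — THE K0 ASSEMBLER's ARITHMETIC KIT FOR THE ONE BUDGET ROW OF MODULE 83: PRINT's LETTER SHAPES ((160) `δ`-LINEAR NEAR
# ROWS, (165) `ε²`-TYPE (158) LETTERS, (163) THE COLLAR THRESHOLD) CLOSE THE ROW — MODULE 85

Cell `pub-ymgap`, seat `pub-ymgap-dag-n07-e` g27 (FAN-OUT §N07 row s3; LANE OWNER of the K0 road), MODULE 85 (INTENT-85, cell bus).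
`--kind proof --supports stmt-QuantumFields-20541 --as helper` (K0⁷); count-neutral; def-free; PURE REAL ARITHMETIC (no lattice object is read).
[15] = [Balaban1985Variational]; [6] = [Balaban1985RegularSpaces].

WHY.  MODULE 83 `prop8RegSepTopStepG_of_hThm4Rec_of_letters` displays ONE budget row in the two chart letters `β₁` ((c′)'s near-row letter) and `t₁` ((d′)'s (158) letter), ranged over the
token's `0 < δ_j ≤ a₁`, `B₃δ_j ≤ ε_j ≤ a₀`:
    `t₁ ε δ j + ¼·S·max (4C_H B_H·β₁ ε δ j) (8C_H B_H e^{−δ_H ρ}·(κ·L·ε_j)) < C δ_j + θ ε_j + Q ε_j²`   (`S = sideP`),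
next to the chain's side conditions `2L² ≤ B₃`, `4C ≤ B₃`, `16θ ≤ 1`, `(16Q + 1024κ²)·a₀ ≤ 1`, `32κ·a₀ ≤ 1`.  Print's letters have the SHAPES (160) `|B| < (8d²L² + 4L²|x−y|)ε₁` (near rows:
`δ`-linear, the tree's `δ` = print's data tolerance `ε₁`), (156)'s linearisation remainder `O(|A|²) = O(κ²ε²)` (`ε²`-type), (165) `B₀(C₄ + 4C₂)(36dL²B₁R₁M₁)²(M′ε₀)²` (the (158) letters:
`ε²`-type), and print closes the budget by (163) «We may assume that R₁M₁ is sufficiently big» (the far-datum `e^{−δ₀R₁M₁}` term against (152)'s `36dL²B₁Mε₀`) and (166) (the `ε²` terms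
against `⅛`).  This file is that arithmetic, once, for AFFINE-QUADRATIC letter shapes `x ε δ j ≤ x₀·δ_j + x₂·ε_j²` (both letters), so that the K0 assembler's remaining work on the row is to
read the four shape coefficients off the pens' files and to pick the collar above the threshold of §2 (which is why the premise of record must allow it: ⚑ LOCATED-COLLAR-THRESHOLD, MODULE 84).

WHAT IS PROVED (sorry-free; no definition; axioms standard; no lattice object).
* §1 `budgetRow_of_affine_letters` — at one `(ε, δ)` point with `0 < δ`, `0 < ε`: if `0 ≤ β ≤ b₀δ + b₂ε²`, `t ≤ τ₀δ + τ₂ε²`, and the constants satisfy `τ₀ + S·C_H·B_H·b₀ ≤ C`,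
  `τ₂ + S·C_H·B_H·b₂ ≤ Q`, `2·S·C_H·B_H·E·κ·L < θ` (`E` the collar factor `e^{−δ_H ρ}`, all of `S, C_H, B_H, E, κ, L ≥ 0`), then
  `t + ¼·S·max (4C_H B_H·β) (8C_H B_H·E·(κ·L·ε)) < Cδ + θε + Qε²`.
* §1b `budgetRow83_of_affine_letters` — the same, quantified exactly as MODULE 83's binder (∀ `K ε δ j` in range, `S := sideP (F.P K) Mc ρ`, `E := e^{−δ_H ρ}`), from the ranged shape
  hypotheses on `β₁`, `t₁` and the three constant rows with `S` replaced by any UNIFORM bound `S̄ ≥ sideP (F.P K) Mc ρ` (all `K`; `sideP` does not depend on `K` beyond `d = 4`).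
* §2 `exists_threshold_pow_mul_exp_neg_lt` — for `0 < δ_H`, `0 ≤ c`, every degree `n` and every target `0 < τ`: `∃ ρ⋆, ∀ ρ ≥ ρ⋆, c·ρ^n·e^{−δ_H ρ} < τ` (print (163): the collar AFTER the
  constants); `exists_nat_threshold_pow_mul_exp_neg_lt` — the same over `ρ : ℕ`.
HONEST SCOPE: count-neutral real arithmetic; it discharges NOTHING by itself (the shape hypotheses on `β₁`, `t₁` are the pens' deliverables, the threshold needs the collar-uniform premise);
K0⁷ ∕ K1⁹ NOT closed; N07 NOT discharged; counts unmoved (typed 28∕28 · discharged 8∕27); one finite 𝕋⁴ programme at fixed ε — the route closes the conditional finite-𝕋⁴ rung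
`BalabanLadder.UV` ONLY; the YM mass gap (Clay) is NOT proved by any of this; nothing continuum ∕ ℝ⁴ ∕ OS.  No `sorry` ∕ `def` ∕ `instance` ∕ `notation`.

References: [15] (152) p. 301, (156) p. 302, (160)–(166) pp. 303–304, Prop. 8 p. 304; [6] Prop. 6 p. 99.
-/

set_option autoImplicit false

noncomputable section

open Filter Topology

namespace Summit.QuantumFields.YangMills.BalabanUVNodes.N07HeadBudgetArithmetic

open Literature.MathematicalPhysics.QuantumFieldTheory.Balaban1983to89
open Literature.MathematicalPhysics.QuantumFieldTheory.Balaban1983to89.Node00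
open T4Continuum (T4Family)

/-! ## §1  The budget row at one point from affine-quadratic letter shapes -/

/-- **THE BUDGET ROW FROM PRINT's LETTER SHAPES, AT ONE POINT** `(ε, δ)`, `0 < δ`, `0 < ε`: near-row letter `0 ≤ β ≤ b₀δ + b₂ε²` ((160) + (156)'s remainder), (158) letter
`t ≤ τ₀δ + τ₂ε²` ((165)), constants `τ₀ + S·C_H B_H·b₀ ≤ C`, `τ₂ + S·C_H B_H·b₂ ≤ Q`, far-datum row `2·S·C_H B_H·E·κ·L < θ` ((163)) ⟹
`t + ¼·S·max (4C_H B_H·β) (8C_H B_H·E·(κ·L·ε)) < Cδ + θε + Qε²`.  Pure arithmetic (`max ≤ sum` of the two non-negative floors; strictness from the far-datum row and `0 < ε`).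
[cite: Balaban1985Variational, (160)–(166) pp.303–304] -/
theorem budgetRow_of_affine_letters {S CH BH E κ L θ C Q β t b₀ b₂ τ₀ τ₂ ε δ : ℝ}
    (hS : 0 ≤ S) (hCH : 0 ≤ CH) (hBH : 0 ≤ BH) (hE : 0 ≤ E) (hκ : 0 ≤ κ) (hL : 0 ≤ L) (hδ : 0 < δ) (hε : 0 < ε)
    (hβ0 : 0 ≤ β) (hβ : β ≤ b₀ * δ + b₂ * ε ^ 2) (ht : t ≤ τ₀ * δ + τ₂ * ε ^ 2)
    (hC : τ₀ + S * CH * BH * b₀ ≤ C) (hQ : τ₂ + S * CH * BH * b₂ ≤ Q) (hθ : 2 * S * CH * BH * E * κ * L < θ) :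
    t + 1 / 4 * S * max (4 * CH * BH * β) (8 * CH * BH * E * (κ * L * ε)) < C * δ + θ * ε + Q * ε ^ 2 := by
  have hSCB : 0 ≤ S * CH * BH := mul_nonneg (mul_nonneg hS hCH) hBH
  have hfar0 : 0 ≤ 8 * CH * BH * E * (κ * L * ε) := by positivity
  have hnear0 : 0 ≤ 4 * CH * BH * β := by positivity
  -- `max ≤ sum` for the two non-negative floors
  have hmax : max (4 * CH * BH * β) (8 * CH * BH * E * (κ * L * ε)) ≤ 4 * CH * BH * β + 8 * CH * BH * E * (κ * L * ε) :=
    max_le (le_add_of_nonneg_right hfar0) (le_add_of_nonneg_left hnear0)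
  have h1 : 1 / 4 * S * max (4 * CH * BH * β) (8 * CH * BH * E * (κ * L * ε)) ≤
      S * CH * BH * β + 2 * S * CH * BH * E * κ * L * ε := by
    have := mul_le_mul_of_nonneg_left hmax (by positivity : (0 : ℝ) ≤ 1 / 4 * S)
    linarith [this]
  -- the near floor against `C δ + Q ε²`, the far floor STRICTLY against `θ ε`
  have h2 : S * CH * BH * β ≤ S * CH * BH * (b₀ * δ + b₂ * ε ^ 2) := mul_le_mul_of_nonneg_left hβ hSCB
  have h3 : 2 * S * CH * BH * E * κ * L * ε < θ * ε := mul_lt_mul_of_pos_right hθ hε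
  have hε2 : 0 ≤ ε ^ 2 := sq_nonneg ε
  have h4 : (τ₀ + S * CH * BH * b₀) * δ ≤ C * δ := mul_le_mul_of_nonneg_right hC hδ.le
  have h5 : (τ₂ + S * CH * BH * b₂) * ε ^ 2 ≤ Q * ε ^ 2 := mul_le_mul_of_nonneg_right hQ hε2
  nlinarith [h1, h2, h3, h4, h5, ht]

/-- **THE BUDGET ROW OF MODULE 83, QUANTIFIED AS ITS BINDER**, from RANGED affine-quadratic shapes of the two chart letters and three constant rows at a uniform side bound `S̄ ≥ sideP`
(`sideP (F.P K) Mc ρ` is the same number for every `K`): for `0 ≤ C_H, B_H, κ`, `0 ≤ b₀, b₂`, if on the token's range `0 ≤ β₁ ε δ j ≤ b₀δ_j + b₂ε_j²` and `t₁ ε δ j ≤ τ₀δ_j + τ₂ε_j²`,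
and `τ₀ + S̄·C_H B_H·b₀ ≤ C`, `τ₂ + S̄·C_H B_H·b₂ ≤ Q`, `2·S̄·C_H B_H·e^{−δ_H ρ}·κ·L < θ`, then 83's row holds for every `K` and every `(ε, δ, j)` in range.
[cite: Balaban1985Variational, (160)–(166) pp.303–304] -/
theorem budgetRow83_of_affine_letters (F : T4Family) {Mc ρ : ℕ} {CH BH δH κ θ C Q B₃ a₀ a₁ b₀ b₂ τ₀ τ₂ Sbar : ℝ}
    (hCH : 0 ≤ CH) (hBH : 0 ≤ BH) (hκ : 0 ≤ κ) (hB₃ : 0 < B₃) (hb₀ : 0 ≤ b₀) (hb₂ : 0 ≤ b₂)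
    (hSbar : ∀ K : ℕ, ((sideP (F.P K) Mc ρ : ℕ) : ℝ) ≤ Sbar)
    (β₁ t₁ : (ℕ → ℝ) → (ℕ → ℝ) → ℕ → ℝ)
    (hβ₁ : ∀ (ε δ : ℕ → ℝ) (j : ℕ), 0 < δ j → δ j ≤ a₁ → B₃ * δ j ≤ ε j → ε j ≤ a₀ → 0 ≤ β₁ ε δ j ∧ β₁ ε δ j ≤ b₀ * δ j + b₂ * ε j ^ 2)
    (ht₁ : ∀ (ε δ : ℕ → ℝ) (j : ℕ), 0 < δ j → δ j ≤ a₁ → B₃ * δ j ≤ ε j → ε j ≤ a₀ → t₁ ε δ j ≤ τ₀ * δ j + τ₂ * ε j ^ 2)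
    (hC : τ₀ + Sbar * CH * BH * b₀ ≤ C) (hQ : τ₂ + Sbar * CH * BH * b₂ ≤ Q) (hθ : 2 * Sbar * CH * BH * Real.exp (-(δH * (ρ : ℝ))) * κ * F.L < θ) :
    ∀ (K : ℕ) (ε δ : ℕ → ℝ) (j : ℕ), 0 < δ j → δ j ≤ a₁ → B₃ * δ j ≤ ε j → ε j ≤ a₀ →
      t₁ ε δ j + 1 / 4 * ((sideP (F.P K) Mc ρ : ℕ) : ℝ) *
          max (4 * CH * BH * β₁ ε δ j) (8 * CH * BH * Real.exp (-(δH * (ρ : ℝ))) * (κ * (F.L : ℝ) * ε j)) <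
        C * δ j + θ * ε j + Q * ε j ^ 2 := by
  intro K ε δ j hδ hδa hBδ hεa
  have hε : 0 < ε j := lt_of_lt_of_le (mul_pos hB₃ hδ) hBδ
  obtain ⟨hβ0, hβ⟩ := hβ₁ ε δ j hδ hδa hBδ hεa
  have hS : (0 : ℝ) ≤ ((sideP (F.P K) Mc ρ : ℕ) : ℝ) := Nat.cast_nonneg _
  have hSK := hSbar K
  have hE : 0 ≤ Real.exp (-(δH * (ρ : ℝ))) := (Real.exp_pos _).le
  have hL : (0 : ℝ) ≤ (F.L : ℝ) := Nat.cast_nonneg _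
  have hCHBH : 0 ≤ CH * BH := mul_nonneg hCH hBH
  -- the three constant rows at `S := sideP ≤ S̄`
  have hC' : τ₀ + ((sideP (F.P K) Mc ρ : ℕ) : ℝ) * CH * BH * b₀ ≤ C := by
    have h0 := mul_le_mul_of_nonneg_right hSK (mul_nonneg hCHBH hb₀)
    linarith [h0]
  have hQ' : τ₂ + ((sideP (F.P K) Mc ρ : ℕ) : ℝ) * CH * BH * b₂ ≤ Q := by
    have h0 := mul_le_mul_of_nonneg_right hSK (mul_nonneg hCHBH hb₂)
    linarith [h0]
  have hθ' : 2 * ((sideP (F.P K) Mc ρ : ℕ) : ℝ) * CH * BH * Real.exp (-(δH * (ρ : ℝ))) * κ * F.L < θ := by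
    have : 2 * ((sideP (F.P K) Mc ρ : ℕ) : ℝ) * CH * BH * Real.exp (-(δH * (ρ : ℝ))) * κ * F.L ≤
        2 * Sbar * CH * BH * Real.exp (-(δH * (ρ : ℝ))) * κ * F.L := by
      have h0 : 0 ≤ 2 * (CH * BH * Real.exp (-(δH * (ρ : ℝ))) * κ * F.L) := by positivity
      have h1 := mul_le_mul_of_nonneg_right hSK h0
      linarith [h1]
    exact this.trans_lt hθ
  exact budgetRow_of_affine_letters hS hCH hBH hE hκ hL hδ hε hβ0 hβ (ht₁ ε δ j hδ hδa hBδ hεa) hC' hQ' hθ'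

/-! ## §2  The collar threshold: a polynomial against `e^{−δ_H ρ}` (print (163)) -/

/-- **`c·ρⁿ·e^{−δ_H ρ} < τ` FOR ALL LARGE `ρ`** (`0 < δ_H`, `0 < τ`, any `c`, any degree `n`): print's «We may assume that R₁M₁ is sufficiently big, so that (163)».  Folklore
(`Real.tendsto_pow_mul_exp_neg_atTop_nhds_zero` rescaled). [cite: Balaban1985Variational, (163) p.304] -/
theorem exists_threshold_pow_mul_exp_neg_lt {δH : ℝ} (hδH : 0 < δH) (c : ℝ) (n : ℕ) {τ : ℝ} (hτ : 0 < τ) :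
    ∃ ρ₀ : ℝ, ∀ ρ : ℝ, ρ₀ ≤ ρ → c * ρ ^ n * Real.exp (-(δH * ρ)) < τ := by
  -- `y ↦ yⁿ e^{−δ_H y} → 0`
  have h := ((Real.tendsto_pow_mul_exp_neg_atTop_nhds_zero n).comp (tendsto_id.const_mul_atTop hδH)).const_mul (c * (δH ^ n)⁻¹)
  rw [mul_zero] at h
  have h' : Tendsto (fun y : ℝ => c * y ^ n * Real.exp (-(δH * y))) atTop (𝓝 0) := by
    refine h.congr fun y => ?_
    have hδn : δH ^ n ≠ 0 := pow_ne_zero _ hδH.ne'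
    simp only [Function.comp_apply, id_eq, mul_pow]
    field_simp
  obtain ⟨ρ₀, hρ₀⟩ := eventually_atTop.1 (h'.eventually (Iio_mem_nhds hτ))
  exact ⟨ρ₀, fun ρ hρ => hρ₀ ρ hρ⟩

/-- The same threshold over natural collars `ρ : ℕ`. [cite: Balaban1985Variational, (163) p.304] -/
theorem exists_nat_threshold_pow_mul_exp_neg_lt {δH : ℝ} (hδH : 0 < δH) (c : ℝ) (n : ℕ) {τ : ℝ} (hτ : 0 < τ) :
    ∃ ρ₀ : ℕ, ∀ ρ : ℕ, ρ₀ ≤ ρ → c * (ρ : ℝ) ^ n * Real.exp (-(δH * (ρ : ℝ))) < τ := by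
  obtain ⟨r₀, hr₀⟩ := exists_threshold_pow_mul_exp_neg_lt hδH c n hτ
  refine ⟨⌈max r₀ 0⌉₊, fun ρ hρ => hr₀ ρ ?_⟩
  have h1 : max r₀ 0 ≤ (⌈max r₀ 0⌉₊ : ℝ) := Nat.le_ceil _
  have h2 : ((⌈max r₀ 0⌉₊ : ℕ) : ℝ) ≤ (ρ : ℝ) := by exact_mod_cast hρ
  exact (le_max_left _ _).trans (h1.trans h2)

end Summit.QuantumFields.YangMills.BalabanUVNodes.N07HeadBudgetArithmetic

end
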